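import Summits.Ventures.HSemireg.WedgePointPairPowersPerQDegreeTwo

/-!
# Venture HSemireg — per-`q` blocks of the `n`-fold box of `m`-dimensional point pairs, companion: THE DEGREE-3 ROW (the `Ext³` /
# `HT³`-degree of the dictionary, STRUCTURE C14's degree) IN CLOSED FORM for every `m ≥ 1` and every `n`

HONEST FRAMING. Part of the Lean index of the computation cell `pub-hsemireg` (seat p10 gen 5, Sunday typer «UNIFORM-IN-n»).
Natural-number arithmetic of p10's enumerator `genCount` + the rank theorem of `WedgePointPairPowersPerQRank.lean` ONLY: no variety,
no cohomology theory, no sheaf, no Ext group, no semiregularity map is constructed here; nothing here says that HC / HC_CM / HC_AV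
holds; no Literature fact is declared or used.  Custodian versions: STRUCTURE.md v1.0-SIGNED 9b196a05977dd067 (§1.1 C13 per-q law, C14
«HT³ box column `[t³]P_n² = 4C(2n,3) − 4C(n,3)`»), theory/FORMULA-N.md PART A §4.1″ (th-6: degree-3 two-factor row `(C(2n,3), 2C(n,3),
n²(n−1), n²(n−1), 2C(n,3), C(2n,3))` at `q = (0, n−3, n−2, n−1, n, 2n−3)`, tree `FormulaNUniformBlocks.blockCount_three`) / PART B (th-7).
Dictionary quoted, not asserted.

THIS FILE = the degree-3 instance of the SHAPE EXPANSION of `WedgePointPairPowersPerQDegreeTwo.genCount_eq_sum_shapes`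
(`genCount m n k q = Σ_{p ≤ k} C(n,p) Σ_{j ≤ n−p, mj ≤ q} [t^k u^{q−mj}] R_m^p`), done with the same two steps as degree 2.
§1 the three degree-3 shape coefficients, FACTORED as (letter count) × (0/1/2/3-indicator): `[t³ u^r] R_m = qAtom m 3 r =
C(m,3)·([r = 0] + [3 < m][r = m−3])`; **`[t³ u^r] R_m² = 2m·C(m,2)·([r = 0] + [1<m][r = m−1] + [2<m][r = m−2] + [2<m][r = 2m−3])`**
(one degree-1 and one degree-2 atom in either order, `rbPow_two_three_closed`); **`[t³ u^r] R_m³ = m³·([r = 0] + 3[1<m][r = m−1] +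
3[1<m][r = 2m−2] + [1<m][r = 3m−3])`** (three degree-1 atoms: the cube of `global + local`, `rbPow_three_three_closed`); on the way the
degree-2 coefficient of the parent in the same factored shape (`rbPow_two_two_closed`).
§2 `genCount m n 3 q = n·S₁ + C(n,2)·S₂ + C(n,3)·S₃` with the three shift sums over `j < n`, `j < n − 1`, `j < n − 2`
(`genCount_three_eq_add`, every `n`).
§3 the shift sums in closed form (`shift_three_one`, `shift_three_two`, `shift_three_three`).
§4 **THE DEGREE-3 ROW, UNIFORM IN `n` AND `m`** (`genCount_three_closed`; RANK statement `finrank_range_blockProj_wedge_pairBox_three_closed`;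
class count `card_Fset_three_closed`):
  `rank_q(⋀³) = n·C(m,3)·([∃ j<n, q = mj] + [3<m][∃ j<n, q = m−3+mj])`
  `  + C(n,2)·2m·C(m,2)·([∃ j<n−1, q = mj] + [1<m][… q = m−1+mj] + [2<m][… q = m−2+mj] + [2<m][… q = 2m−3+mj])`
  `  + C(n,3)·m³·([∃ j<n−2, q = mj] + 3[1<m][… q = m−1+mj] + 3[1<m][… q = 2m−2+mj] + [1<m][… q = 3m−3+mj])`.
§5 EDGES AND ROWS: `n = 2` is th-6's two-factor degree-3 row `blockCount m 3` (via `WedgePointPairPowersPerQRank.genCount_two_factors_eq_blockCount`,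
closed form `FormulaNUniformBlocks.blockCount_three` for `m ≥ 4`); `m = 2` the surface rows `spCount n 3` (`(20,36,36,20)`, `(56,120,152,152,120,56)`,
closed form `FormulaNSurfacePowerPerQClosed.spCount_three_closed`); `m = 1` reads `C(n,3)·[q ≤ n − 3]` (`genCount_three_closed_one`); `n = 1`
THEOREM T's atom `qAtom m 3` (`genCount_three_closed_single`); rows by `decide` from the closed form (`genCount_three_rows`): the
pre-registered `m = n = 3` degree-3 row `(84,54,135,111,135,54,84,0,0,0)` (`FormulaNPerQUniform.genCount_predictions_three`), the surface
row `n = 4` `(56,120,152,152,120,56,0,0)`, and a NEW pre-registration `m = 4`, `n = 3` (fourfold factors, `24` generators, blocks `q = 0..12`):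
`(220,12,144,336,156,156,336,144,12,220,0,0,0)`, sum `1736 = [t³]P_4³ + 3·[t³]P_4² = 1112 + 624`.
WHAT IS NOT HERE: anything Ext-side; the rows `k ≥ 4`.  Namespaces `Summit.Ventures.HSemireg.FormulaN.Uniform` (arithmetic) and
`Summit.Ventures.HSemireg.Wedge.PairPowers` (rank / class count); new names only; a LEAF over `WedgePointPairPowersPerQDegreeTwo.lean`.
-/

open Finset

namespace Summit.Ventures.HSemireg.FormulaN.Uniform

/-! ## §1. The degree-3 shape coefficients `[t³ u^r] R_m^p`, `p = 1, 2, 3` (factored) -/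

/-- the degree-1 atom, factored: `qAtom m 1 s = m·([s = 0] + [1 < m][s = m − 1])`. -/
theorem qAtom_one_factored (m s : ℕ) :
    qAtom m 1 s = m * ((if s = 0 then 1 else 0) + (if 1 < m ∧ s = m - 1 then 1 else 0)) := by
  rw [qAtom, Nat.choose_one_right]
  split_ifs <;> omega

/-- the parent's degree-2 coefficient, factored: `[t² u^r] R_m² = m²·([r = 0] + 2[1<m][r = m−1] + [1<m][r = 2m−2])`. -/
theorem rbPow_two_two_closed {m : ℕ} (hm : 1 ≤ m) (r : ℕ) :
    rbPow m 2 2 r = m * m * ((if r = 0 then 1 else 0) + (if 1 < m ∧ r = m - 1 then 2 else 0) +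
      (if 1 < m ∧ r = 2 * m - 2 then 1 else 0)) := by
  rw [rbPow_two_two hm, sum_antidiagonal_qAtom, Nat.choose_one_right, show m - 1 + (m - 1) = 2 * m - 2 by omega]
  generalize m * m = M
  by_cases h1 : 1 < m
  · simp only [h1, true_and]
    split_ifs <;> omega
  · simp only [h1, false_and, if_false, add_zero]
    split_ifs <;> omega

/-- `[t³ u^r] R_m¹ = qAtom m 3 r` (`m ≥ 1`). -/
theorem rbPow_one_three {m : ℕ} (hm : 1 ≤ m) (r : ℕ) : rbPow m 1 3 r = qAtom m 3 r := by
  rw [rbPow_one hm, atomR_of_ne_zero m (by decide : (3 : ℕ) ≠ 0)]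

/-- `[t³ u^r] R_m²`: one degree-1 and one degree-2 atom, in either order (the splits `(0,3)`, `(3,0)` vanish). -/
theorem rbPow_two_three {m : ℕ} (hm : 1 ≤ m) (r : ℕ) :
    rbPow m 2 3 r = ∑ ps ∈ antidiagonal r, qAtom m 1 ps.1 * qAtom m 2 ps.2 +
      ∑ ps ∈ antidiagonal r, qAtom m 2 ps.1 * qAtom m 1 ps.2 := by
  rw [rbPow, Nat.sum_antidiagonal_eq_sum_range_succ
    (fun a b => ∑ pr ∈ antidiagonal r, rbPow m 1 a pr.1 * atomR m b pr.2) 3]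
  simp only [Finset.sum_range_succ, Finset.sum_range_zero, zero_add, rbPow_one hm, atomR_zero, zero_mul, mul_zero,
    Finset.sum_const_zero, add_zero, Nat.sub_zero, Nat.sub_self, show 3 - 1 = 2 from rfl, show 3 - 2 = 1 from rfl,
    atomR_of_ne_zero m one_ne_zero, atomR_of_ne_zero m two_ne_zero]

/-- **`[t³ u^r] R_m² = 2m·C(m,2)·([r = 0] + [1<m][r = m−1] + [2<m][r = m−2] + [2<m][r = 2m−3])`** (global·global; global letter ·
local pair; local letter · global pair; local·local — each ordered pair of atoms twice). -/
theorem rbPow_two_three_closed {m : ℕ} (hm : 1 ≤ m) (r : ℕ) :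
    rbPow m 2 3 r = 2 * (m * m.choose 2) * ((if r = 0 then 1 else 0) + (if 1 < m ∧ r = m - 1 then 1 else 0) +
      (if 2 < m ∧ r = m - 2 then 1 else 0) + (if 2 < m ∧ r = 2 * m - 3 then 1 else 0)) := by
  rw [rbPow_two_three hm, sum_antidiagonal_qAtom, sum_antidiagonal_qAtom, Nat.choose_one_right, mul_comm (m.choose 2) m,
    show m - 1 + (m - 2) = 2 * m - 3 by omega, show m - 2 + (m - 1) = 2 * m - 3 by omega]
  generalize m * m.choose 2 = M
  by_cases h1 : 1 < m <;> by_cases h2 : 2 < m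
  · simp only [h1, h2, true_and]
    split_ifs <;> omega
  · simp only [h1, h2, true_and, false_and, if_false, add_zero]
    split_ifs <;> omega
  · omega
  · simp only [h1, h2, false_and, if_false, add_zero]
    split_ifs <;> omega

/-- `[t³ u^r] R_m³`: only the split (degree 2 from two factors) · (degree 1) survives. -/
theorem rbPow_three_three (m r : ℕ) :
    rbPow m 3 3 r = ∑ ps ∈ antidiagonal r, rbPow m 2 2 ps.1 * qAtom m 1 ps.2 := by
  have e0 : ∀ q, rbPow m 2 0 q = 0 := fun q => rbPow_eq_zero_of_lt m 2 0 q (by norm_num)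
  have e1 : ∀ q, rbPow m 2 1 q = 0 := fun q => rbPow_eq_zero_of_lt m 2 1 q (by norm_num)
  rw [rbPow, Nat.sum_antidiagonal_eq_sum_range_succ
    (fun a b => ∑ pr ∈ antidiagonal r, rbPow m 2 a pr.1 * atomR m b pr.2) 3]
  simp only [Finset.sum_range_succ, Finset.sum_range_zero, zero_add, e0, e1, atomR_zero, zero_mul, mul_zero,
    Finset.sum_const_zero, add_zero, Nat.sub_self, show 3 - 2 = 1 from rfl, atomR_of_ne_zero m one_ne_zero]

/-- the pure indicator convolution behind `R_m³` in degree 3: `(1 + 2v + v²) ⋆ (1 + v) = 1 + 3v + 3v² + v³` on the exponents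
`0, m−1, 2m−2, 3m−3` (`v = [1 < m]·u^{m−1}`). -/
theorem conv_indicator_three (m r : ℕ) :
    ∑ ps ∈ antidiagonal r, ((if ps.1 = 0 then 1 else 0) + (if 1 < m ∧ ps.1 = m - 1 then 2 else 0) +
        (if 1 < m ∧ ps.1 = 2 * m - 2 then 1 else 0)) * ((if ps.2 = 0 then 1 else 0) + (if 1 < m ∧ ps.2 = m - 1 then 1 else 0)) =
      (if r = 0 then 1 else 0) + (if 1 < m ∧ r = m - 1 then 3 else 0) + (if 1 < m ∧ r = 2 * m - 2 then 3 else 0) +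
        (if 1 < m ∧ r = 3 * m - 3 then 1 else 0) := by
  by_cases h1 : 1 < m
  · simp only [h1, true_and]
    have e : ∀ ps : ℕ × ℕ, ((if ps.1 = 0 then 1 else 0) + (if ps.1 = m - 1 then 2 else 0) + (if ps.1 = 2 * m - 2 then 1 else 0)) *
        ((if ps.2 = 0 then 1 else 0) + (if ps.2 = m - 1 then 1 else 0)) =
        (if ps.1 = 0 then 1 else 0) * (if ps.2 = 0 then 1 else 0) + (if ps.1 = 0 then 1 else 0) * (if ps.2 = m - 1 then 1 else 0) +
        (if ps.1 = m - 1 then 2 else 0) * (if ps.2 = 0 then 1 else 0) + (if ps.1 = m - 1 then 2 else 0) * (if ps.2 = m - 1 then 1 else 0) +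
        (if ps.1 = 2 * m - 2 then 1 else 0) * (if ps.2 = 0 then 1 else 0) +
        (if ps.1 = 2 * m - 2 then 1 else 0) * (if ps.2 = m - 1 then 1 else 0) := fun ps => by ring
    simp only [e, Finset.sum_add_distrib, sum_antidiagonal_ite_mul_ite, zero_add, add_zero]
    rw [show m - 1 + (m - 1) = 2 * m - 2 by omega, show 2 * m - 2 + (m - 1) = 3 * m - 3 by omega]
    split_ifs <;> omega
  · simp only [h1, false_and, if_false, add_zero]
    rw [sum_antidiagonal_ite_mul_ite]

/-- **`[t³ u^r] R_m³ = m³·([r = 0] + 3[1<m][r = m−1] + 3[1<m][r = 2m−2] + [1<m][r = 3m−3])`** — three degree-1 atoms on three blocks: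
`(global + local)³`. -/
theorem rbPow_three_three_closed {m : ℕ} (hm : 1 ≤ m) (r : ℕ) :
    rbPow m 3 3 r = m * m * m * ((if r = 0 then 1 else 0) + (if 1 < m ∧ r = m - 1 then 3 else 0) +
      (if 1 < m ∧ r = 2 * m - 2 then 3 else 0) + (if 1 < m ∧ r = 3 * m - 3 then 1 else 0)) := by
  rw [rbPow_three_three, ← conv_indicator_three m r, Finset.mul_sum]
  refine Finset.sum_congr rfl fun ps _ => ?_
  rw [rbPow_two_two_closed hm, qAtom_one_factored]
  ring

/-! ## §2. Degree 3: one, two or three non-empty blocks -/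

/-- **in degree 3 a class occupies one, two or three blocks**: for every `m ≥ 1`, `n`, `q`,
`genCount m n 3 q = n·Σ_{j<n} [t³]R_m(q−mj) + C(n,2)·Σ_{j<n−1} [t³]R_m²(q−mj) + C(n,3)·Σ_{j<n−2} [t³]R_m³(q−mj)` (shape expansion at
`k = 3`). -/
theorem genCount_three_eq_add {m : ℕ} (hm : 1 ≤ m) (n q : ℕ) :
    genCount m n 3 q =
      n * ∑ j ∈ range n, (if m * j ≤ q then qAtom m 3 (q - m * j) else 0) +
      n.choose 2 * ∑ j ∈ range (n - 1), (if m * j ≤ q then rbPow m 2 3 (q - m * j) else 0) +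
      n.choose 3 * ∑ j ∈ range (n - 2), (if m * j ≤ q then rbPow m 3 3 (q - m * j) else 0) := by
  rw [genCount_eq_sum_shapes, Finset.sum_range_succ, Finset.sum_range_succ, Finset.sum_range_succ, Finset.sum_range_succ,
    Finset.sum_range_zero, zero_add, Nat.choose_zero_right, Nat.choose_one_right, one_mul,
    show n + 1 - 1 = n by omega, show n + 1 - 2 = n - 1 by omega, show n + 1 - 3 = n - 2 by omega]
  have h0 : ∑ j ∈ range (n + 1 - 0), (if m * j ≤ q then rbPow m 0 3 (q - m * j) else 0) = 0 :=
    Finset.sum_eq_zero fun j _ => by simp [rbPow]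
  rw [h0, zero_add]
  congr 1
  congr 1
  congr 1
  refine Finset.sum_congr rfl fun j _ => ?_
  rw [rbPow_one_three hm]

/-! ## §3. The three shift sums in closed form -/

/-- one degree-3 atom shifted: `Σ_{j<J, mj ≤ q} qAtom m 3 (q − mj) = C(m,3)·([∃ j<J, q = mj] + [3<m][∃ j<J, q = m−3+mj])`. -/
theorem shift_three_one {m : ℕ} (hm : 1 ≤ m) (J q : ℕ) :
    ∑ j ∈ range J, (if m * j ≤ q then qAtom m 3 (q - m * j) else 0) =
      (if ∃ j, j < J ∧ q = m * j then m.choose 3 else 0) +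
      (if 3 < m ∧ ∃ j, j < J ∧ q = m - 3 + m * j then m.choose 3 else 0) := by
  have h1 : ∀ j, (if m * j ≤ q then qAtom m 3 (q - m * j) else 0) =
      (if q = m * j then m.choose 3 else 0) + (if 3 < m ∧ q = m - 3 + m * j then m.choose 3 else 0) := by
    intro j
    rw [qAtom]
    generalize m * j = x
    generalize m.choose 3 = c
    split_ifs <;> omega
  simp_rw [h1]
  rw [Finset.sum_add_distrib, sum_range_ite_unique (fun j => q = m * j) J (m.choose 3)
    (fun a b ha hb => Nat.eq_of_mul_eq_mul_left hm (ha.symm.trans hb)),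
    sum_range_ite_and_unique (3 < m) (fun j => q = m - 3 + m * j) J (m.choose 3)
      (fun a b ha hb => Nat.eq_of_mul_eq_mul_left hm (Nat.add_left_cancel (ha.symm.trans hb)))]

/-- the two-block shapes shifted: `Σ_{j<J, mj ≤ q} [t³]R_m²(q − mj) =
2m·C(m,2)·([∃ j<J, q = mj] + [1<m][… q = m−1+mj] + [2<m][… q = m−2+mj] + [2<m][… q = 2m−3+mj])`. -/
theorem shift_three_two {m : ℕ} (hm : 1 ≤ m) (J q : ℕ) :
    ∑ j ∈ range J, (if m * j ≤ q then rbPow m 2 3 (q - m * j) else 0) =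
      (if ∃ j, j < J ∧ q = m * j then 2 * (m * m.choose 2) else 0) +
      (if 1 < m ∧ ∃ j, j < J ∧ q = m - 1 + m * j then 2 * (m * m.choose 2) else 0) +
      (if 2 < m ∧ ∃ j, j < J ∧ q = m - 2 + m * j then 2 * (m * m.choose 2) else 0) +
      (if 2 < m ∧ ∃ j, j < J ∧ q = 2 * m - 3 + m * j then 2 * (m * m.choose 2) else 0) := by
  have h1 : ∀ j, (if m * j ≤ q then rbPow m 2 3 (q - m * j) else 0) =
      (if q = m * j then 2 * (m * m.choose 2) else 0) + (if 1 < m ∧ q = m - 1 + m * j then 2 * (m * m.choose 2) else 0) +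
      (if 2 < m ∧ q = m - 2 + m * j then 2 * (m * m.choose 2) else 0) +
      (if 2 < m ∧ q = 2 * m - 3 + m * j then 2 * (m * m.choose 2) else 0) := by
    intro j
    rw [rbPow_two_three_closed hm]
    generalize m * j = x
    generalize m * m.choose 2 = c
    split_ifs <;> omega
  simp_rw [h1]
  rw [Finset.sum_add_distrib, Finset.sum_add_distrib, Finset.sum_add_distrib,
    sum_range_ite_unique (fun j => q = m * j) J _ (fun a b ha hb => Nat.eq_of_mul_eq_mul_left hm (ha.symm.trans hb)),
    sum_range_ite_and_unique (1 < m) (fun j => q = m - 1 + m * j) J _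
      (fun a b ha hb => Nat.eq_of_mul_eq_mul_left hm (Nat.add_left_cancel (ha.symm.trans hb))),
    sum_range_ite_and_unique (2 < m) (fun j => q = m - 2 + m * j) J _
      (fun a b ha hb => Nat.eq_of_mul_eq_mul_left hm (Nat.add_left_cancel (ha.symm.trans hb))),
    sum_range_ite_and_unique (2 < m) (fun j => q = 2 * m - 3 + m * j) J _
      (fun a b ha hb => Nat.eq_of_mul_eq_mul_left hm (Nat.add_left_cancel (ha.symm.trans hb)))]

/-- the three-block shape shifted: `Σ_{j<J, mj ≤ q} [t³]R_m³(q − mj) =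
m³·([∃ j<J, q = mj] + 3[1<m][… q = m−1+mj] + 3[1<m][… q = 2m−2+mj] + [1<m][… q = 3m−3+mj])`. -/
theorem shift_three_three {m : ℕ} (hm : 1 ≤ m) (J q : ℕ) :
    ∑ j ∈ range J, (if m * j ≤ q then rbPow m 3 3 (q - m * j) else 0) =
      (if ∃ j, j < J ∧ q = m * j then m * m * m else 0) +
      (if 1 < m ∧ ∃ j, j < J ∧ q = m - 1 + m * j then 3 * (m * m * m) else 0) +
      (if 1 < m ∧ ∃ j, j < J ∧ q = 2 * m - 2 + m * j then 3 * (m * m * m) else 0) +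
      (if 1 < m ∧ ∃ j, j < J ∧ q = 3 * m - 3 + m * j then m * m * m else 0) := by
  have h1 : ∀ j, (if m * j ≤ q then rbPow m 3 3 (q - m * j) else 0) =
      (if q = m * j then m * m * m else 0) + (if 1 < m ∧ q = m - 1 + m * j then 3 * (m * m * m) else 0) +
      (if 1 < m ∧ q = 2 * m - 2 + m * j then 3 * (m * m * m) else 0) +
      (if 1 < m ∧ q = 3 * m - 3 + m * j then m * m * m else 0) := by
    intro j
    rw [rbPow_three_three_closed hm]
    generalize m * j = x
    generalize m * m * m = c
    split_ifs <;> omega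
  simp_rw [h1]
  rw [Finset.sum_add_distrib, Finset.sum_add_distrib, Finset.sum_add_distrib,
    sum_range_ite_unique (fun j => q = m * j) J _ (fun a b ha hb => Nat.eq_of_mul_eq_mul_left hm (ha.symm.trans hb)),
    sum_range_ite_and_unique (1 < m) (fun j => q = m - 1 + m * j) J _
      (fun a b ha hb => Nat.eq_of_mul_eq_mul_left hm (Nat.add_left_cancel (ha.symm.trans hb))),
    sum_range_ite_and_unique (1 < m) (fun j => q = 2 * m - 2 + m * j) J _
      (fun a b ha hb => Nat.eq_of_mul_eq_mul_left hm (Nat.add_left_cancel (ha.symm.trans hb))),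
    sum_range_ite_and_unique (1 < m) (fun j => q = 3 * m - 3 + m * j) J _
      (fun a b ha hb => Nat.eq_of_mul_eq_mul_left hm (Nat.add_left_cancel (ha.symm.trans hb)))]

/-! ## §4. THE DEGREE-3 ROW in closed form, every `m ≥ 1`, `n` -/

/-- **THE DEGREE-3 ROW OF p10's ENUMERATOR IN CLOSED FORM**, every `m ≥ 1`, `n`, `q` (one degree-3 atom on `n − 1` empty blocks;
a degree-2 and a degree-1 atom on `n − 2`; three degree-1 atoms on `n − 3`; each shifted by `jm` over its empty blocks). -/
theorem genCount_three_closed {m : ℕ} (hm : 1 ≤ m) (n q : ℕ) :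
    genCount m n 3 q =
      n * ((if ∃ j, j < n ∧ q = m * j then m.choose 3 else 0) +
          (if 3 < m ∧ ∃ j, j < n ∧ q = m - 3 + m * j then m.choose 3 else 0)) +
      n.choose 2 * ((if ∃ j, j < n - 1 ∧ q = m * j then 2 * (m * m.choose 2) else 0) +
          (if 1 < m ∧ ∃ j, j < n - 1 ∧ q = m - 1 + m * j then 2 * (m * m.choose 2) else 0) +
          (if 2 < m ∧ ∃ j, j < n - 1 ∧ q = m - 2 + m * j then 2 * (m * m.choose 2) else 0) +
          (if 2 < m ∧ ∃ j, j < n - 1 ∧ q = 2 * m - 3 + m * j then 2 * (m * m.choose 2) else 0)) +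
      n.choose 3 * ((if ∃ j, j < n - 2 ∧ q = m * j then m * m * m else 0) +
          (if 1 < m ∧ ∃ j, j < n - 2 ∧ q = m - 1 + m * j then 3 * (m * m * m) else 0) +
          (if 1 < m ∧ ∃ j, j < n - 2 ∧ q = 2 * m - 2 + m * j then 3 * (m * m * m) else 0) +
          (if 1 < m ∧ ∃ j, j < n - 2 ∧ q = 3 * m - 3 + m * j then m * m * m else 0)) := by
  rw [genCount_three_eq_add hm, shift_three_one hm, shift_three_two hm, shift_three_three hm]

/-! ## §5. Edges and rows -/

/-- **EDGE `n = 1`**: THEOREM T's degree-3 atom `qAtom m 3 q = C(m,3)·([q = 0] + [3 < m][q = m − 3])`. -/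
theorem genCount_three_closed_single {m : ℕ} (hm : 1 ≤ m) (q : ℕ) : genCount m 1 3 q = qAtom m 3 q := by
  rw [genCount_three_eq_add hm]
  simp

/-- **EDGE `m = 1`** (curve factors): `genCount 1 n 3 q = C(n,3)·[q + 3 ≤ n]` — three one-letter blocks, all shifts `q = j ≤ n − 3`. -/
theorem genCount_three_closed_one (n q : ℕ) : genCount 1 n 3 q = if q + 3 ≤ n then n.choose 3 else 0 := by
  rw [genCount_three_closed le_rfl]
  have e : (∃ j, j < n - 2 ∧ q = 1 * j) ↔ q + 3 ≤ n := ⟨fun ⟨j, hj, hq⟩ => by omega, fun h => ⟨q, by omega, (one_mul q).symm⟩⟩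
  simp only [Nat.choose_eq_zero_of_lt (show 1 < 3 by norm_num), Nat.choose_eq_zero_of_lt (show 1 < 2 by norm_num), lt_irrefl,
    (by norm_num : ¬ (2 : ℕ) < 1), (by norm_num : ¬ (3 : ℕ) < 1), false_and, if_false, ite_self, add_zero, mul_zero, zero_add,
    mul_one, if_congr e rfl rfl, mul_ite]

/-- **ROWS** from the closed form, by `decide`: `m = n = 3` degree 3 `(84,54,135,111,135,54,84,0,0,0)` (= the pre-registered row of
`FormulaNPerQUniform.genCount_predictions_three`); the surface row `m = 2`, `n = 4`: `(56,120,152,152,120,56,0,0)`; a NEW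
pre-registration `m = 4`, `n = 3`: `(220,12,144,336,156,156,336,144,12,220,0,0,0)` (sum `1736 = 1112 + 3·208`). -/
theorem genCount_three_rows :
    (List.range 10).map (fun q => genCount 3 3 3 q) = [84, 54, 135, 111, 135, 54, 84, 0, 0, 0] ∧
    (List.range 8).map (fun q => genCount 2 4 3 q) = [56, 120, 152, 152, 120, 56, 0, 0] ∧
    (List.range 13).map (fun q => genCount 4 3 3 q) = [220, 12, 144, 336, 156, 156, 336, 144, 12, 220, 0, 0, 0] := by
  simp only [genCount_three_closed (show 1 ≤ 3 by norm_num), genCount_three_closed (show 1 ≤ 2 by norm_num),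
    genCount_three_closed (show 1 ≤ 4 by norm_num)]
  decide

end Summit.Ventures.HSemireg.FormulaN.Uniform

/-! ## §4 (bis). The degree-3 row as th-7's class count and as a RANK statement -/

open Module

namespace Summit.Ventures.HSemireg.Wedge.PairPowers

open Summit.Ventures.HSemireg.Wedge Summit.Ventures.HSemireg.Wedge.Kunneth

variable (K : Type*) [Field K] {m : ℕ} {n : ℕ}

/-- **th-7's degree-3 classes reaching block `q`, counted in closed form** (every `m ≥ 1`, `n`, `q`). -/
theorem card_Fset_three_closed (hm : 1 ≤ m) (q : ℕ) :
    (Fset m n 3 q).card =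
      n * ((if ∃ j, j < n ∧ q = m * j then m.choose 3 else 0) +
          (if 3 < m ∧ ∃ j, j < n ∧ q = m - 3 + m * j then m.choose 3 else 0)) +
      n.choose 2 * ((if ∃ j, j < n - 1 ∧ q = m * j then 2 * (m * m.choose 2) else 0) +
          (if 1 < m ∧ ∃ j, j < n - 1 ∧ q = m - 1 + m * j then 2 * (m * m.choose 2) else 0) +
          (if 2 < m ∧ ∃ j, j < n - 1 ∧ q = m - 2 + m * j then 2 * (m * m.choose 2) else 0) +
          (if 2 < m ∧ ∃ j, j < n - 1 ∧ q = 2 * m - 3 + m * j then 2 * (m * m.choose 2) else 0)) +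
      n.choose 3 * ((if ∃ j, j < n - 2 ∧ q = m * j then m * m * m else 0) +
          (if 1 < m ∧ ∃ j, j < n - 2 ∧ q = m - 1 + m * j then 3 * (m * m * m) else 0) +
          (if 1 < m ∧ ∃ j, j < n - 2 ∧ q = 2 * m - 2 + m * j then 3 * (m * m * m) else 0) +
          (if 1 < m ∧ ∃ j, j < n - 2 ∧ q = 3 * m - 3 + m * j then m * m * m else 0)) := by
  rw [card_Fset hm, FormulaN.Uniform.genCount_three_closed hm]

/-- **THE DEGREE-3 PER-`q` ROW, UNIFORM IN `n` AND `m`.**  For every field `K`, every `m ≥ 1`, every `n`, every block `q` and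
`a, c ≠ 0`, the rank of the `q`-block of `θ ↦ θ ∧ F` on `⋀³ K^{(m+m)n}` (`F` the `n`-fold box of `m`-dimensional point pairs; in the
dictionary the `Ext³` / `HT³`-degree, read in the Dolbeault block `H^{q+3}(Ω^q)`) is the closed form of `genCount_three_closed`;
`n = 2`: th-6's `(C(2m,3), 2C(m,3), m²(m−1), m²(m−1), 2C(m,3), C(2m,3))`; `m = 2`: `(20,36,36,20)`, `(56,120,152,152,120,56)`;
`m = n = 3`: `(84,54,135,111,135,54,84,0,0,0)`; `m = 4`, `n = 3`: `(220,12,144,336,156,156,336,144,12,220,0,0,0)`. -/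
theorem finrank_range_blockProj_wedge_pairBox_three_closed (hm : 1 ≤ m) {a c : K} (ha : a ≠ 0) (hc : c ≠ 0) (q : ℕ) :
    finrank K (LinearMap.range (blockProj K m n q ∘ₗ wedge K (Fin ((m + m) * n)) 3 (pairBox K (m := m) (n := n) a c))) =
      n * ((if ∃ j, j < n ∧ q = m * j then m.choose 3 else 0) +
          (if 3 < m ∧ ∃ j, j < n ∧ q = m - 3 + m * j then m.choose 3 else 0)) +
      n.choose 2 * ((if ∃ j, j < n - 1 ∧ q = m * j then 2 * (m * m.choose 2) else 0) +
          (if 1 < m ∧ ∃ j, j < n - 1 ∧ q = m - 1 + m * j then 2 * (m * m.choose 2) else 0) +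
          (if 2 < m ∧ ∃ j, j < n - 1 ∧ q = m - 2 + m * j then 2 * (m * m.choose 2) else 0) +
          (if 2 < m ∧ ∃ j, j < n - 1 ∧ q = 2 * m - 3 + m * j then 2 * (m * m.choose 2) else 0)) +
      n.choose 3 * ((if ∃ j, j < n - 2 ∧ q = m * j then m * m * m else 0) +
          (if 1 < m ∧ ∃ j, j < n - 2 ∧ q = m - 1 + m * j then 3 * (m * m * m) else 0) +
          (if 1 < m ∧ ∃ j, j < n - 2 ∧ q = 2 * m - 2 + m * j then 3 * (m * m * m) else 0) +
          (if 1 < m ∧ ∃ j, j < n - 2 ∧ q = 3 * m - 3 + m * j then m * m * m else 0)) := by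
  rw [finrank_range_blockProj_wedge_pairBox K hm ha hc, FormulaN.Uniform.genCount_three_closed hm]

/-- the fourfold-factor pre-registration as a RANK statement: `m = 4`, `n = 3`, degree 3, blocks `q = 0, …, 12`:
`(220,12,144,336,156,156,336,144,12,220,0,0,0)`. -/
theorem perq_row_three_fourfold_triple {a c : K} (ha : a ≠ 0) (hc : c ≠ 0) :
    (List.range 13).map (fun q => finrank K (LinearMap.range
        (blockProj K 4 3 q ∘ₗ wedge K (Fin ((4 + 4) * 3)) 3 (pairBox K (m := 4) (n := 3) a c)))) =
      [220, 12, 144, 336, 156, 156, 336, 144, 12, 220, 0, 0, 0] := by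
  simp only [finrank_range_blockProj_wedge_pairBox K (show 1 ≤ 4 by norm_num) ha hc]
  exact FormulaN.Uniform.genCount_three_rows.2.2

end Summit.Ventures.HSemireg.Wedge.PairPowers
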